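import Summits.QuantumAdvantage.QuantumAdvantage.Theorems.NegApproxGaussRankSuperpoly.Negative.LoadBearing

/-!
# `FlatteningBoundRobust` (stmt-QuantumAdvantage-1246) — negative side II: DICTIONARY RIGIDITY and
# tightness at every `t` (generation-2 negative lemmas)

Second batch of sorry-free, definition-free negative/support lemmas for the crux
`SpinorFlattening.FlatteningBoundRobust` (route QuantumAdvantage/SpinorFlattening, rank 3), extracted
from the standing disprover's work file `Cruxes/FlatteningBoundRobust/Disproof.lean` §G, §H, §A5
(refuter-cdisprove-stmt-QuantumAdvantage-1246-g2-0, 2026-08-16).  Nothing here asserts a Theses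
declaration positively.

* §G DICTIONARY RIGIDITY — why no "fake Gaussian" counterexample exists.  The item's dictionary
  `IsGaussian ψ` only asks for `n` linearly independent ANNIHILATING combinations `c(v) = Σ_p v_p c_p`
  of the `2n` Jordan–Wigner Majoranas; it never says the annihilator space is isotropic/Lagrangian.
  That is automatic: `linComb_anticomm` (bilinear CAR `c(v)c(w) + c(w)c(v) = 2(v·w)·1`),
  `annihilators_orthogonal` (`c(v)ψ = c(w)ψ = 0`, `ψ ≠ 0` ⇒ `v·w = 0`), `annihilatorFamily_isotropic`,
  and MAXIMALITY `card_annihilators_le` (a nonzero vector has at most `n` independent annihilators: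
  isotropic subspaces of the non-degenerate symmetric form `v·w` on `ℂ^{2n}` have dimension `≤ n`,
  via `LinearMap.BilinForm.finrank_add_finrank_orthogonal`), whence `no_overcomplete_annihilators`:
  the dictionary with `n+1` annihilators is EMPTY (a crux typed with `Fin (n+1)` would be vacuous;
  with `Fin n` it is exactly the pure-spinor dictionary).  These are also the first two lines of the
  provers' deficiency step (`stub_normalOrder` of the sibling crux 1245's line).
* §H TIGHTNESS AT EVERY `t` (reusing `normSq_magicMPow` from the sibling crux 1245's
  `Negative/LoadBearing.lean`): `flatteningBoundRobust_tight_K0` (at `(t,0,0)` the count holds and the conclusion is an EQUALITY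
  for every `t` — the constant `1` cannot be improved at any number of copies; generation 1 had
  `t = 1`), `robust_slice_r0` (the `r = 0` slice holds outright, so a counterexample needs `r ≥ 1`,
  hence `K ≥ 1`, where Gaussianity enters).
* §A5 `flatteningBoundRobust_false_with_deficiency_pred`: the deficiency constant is sharp — with
  `D_K(4t) − 1` in the count, `(t,K,r) = (1,1,2)` is admitted (`2·3 < 8`) and the exact 2-term
  decomposition of `|M⟩` has residual `0` (kit j000106: rank F_K(g) = D_K(4t) exactly for generic g).
-/

noncomputable section

set_option linter.dupNamespace false -- D-0017: single-conjunct summit ⇒ `QuantumAdvantage.QuantumAdvantage` by design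

namespace Summit.QuantumAdvantage.QuantumAdvantage.Theorems.FlatteningBoundRobust.Negative

open Matrix Finset
open Literature.Computability.QuantumComplexity Literature.Computability.Cryptography
open Summit.QuantumAdvantage.QuantumAdvantage.Theses.SpinorFlattening (FlatteningBoundRobust)
open Summit.QuantumAdvantage.QuantumAdvantage.Theorems.NegApproxGaussRankSuperpoly.Negative
  (normSq_magicMPow magicMPow_one_eq)

/-! ## §G Dictionary rigidity: the annihilators of ANY nonzero vector are isotropic, at most `n` of
them are independent — there is no "fake Gaussian" to serve as a counterexample. -/

/-- BILINEAR CAR: `c(v) c(w) + c(w) c(v) = 2 (v · w) 1` for linear combinations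
`c(v) = Σ_p v_p c_p` of the Jordan–Wigner Majoranas. [folklore] -/
theorem linComb_anticomm {n : ℕ} (v w : Fin n × Bool → ℂ) :
    (∑ p : Fin n × Bool, v p • majorana n p.1 p.2) * (∑ q : Fin n × Bool, w q • majorana n q.1 q.2) +
      (∑ q : Fin n × Bool, w q • majorana n q.1 q.2) * (∑ p : Fin n × Bool, v p • majorana n p.1 p.2) =
      ((2 : ℂ) * ∑ p : Fin n × Bool, v p * w p) • (1 : Matrix (QReg n) (QReg n) ℂ) := by
  have h1 : (∑ p : Fin n × Bool, v p • majorana n p.1 p.2) * (∑ q : Fin n × Bool, w q • majorana n q.1 q.2) =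
      ∑ p : Fin n × Bool, ∑ q : Fin n × Bool, (v p * w q) • (majorana n p.1 p.2 * majorana n q.1 q.2) := by
    rw [Finset.sum_mul]
    refine Finset.sum_congr rfl fun p _ => ?_
    rw [Finset.mul_sum]
    refine Finset.sum_congr rfl fun q _ => ?_
    rw [Matrix.smul_mul, Matrix.mul_smul, smul_smul]
  have h2 : (∑ q : Fin n × Bool, w q • majorana n q.1 q.2) * (∑ p : Fin n × Bool, v p • majorana n p.1 p.2) =
      ∑ p : Fin n × Bool, ∑ q : Fin n × Bool, (v p * w q) • (majorana n q.1 q.2 * majorana n p.1 p.2) := by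
    have h2' : (∑ q : Fin n × Bool, w q • majorana n q.1 q.2) * (∑ p : Fin n × Bool, v p • majorana n p.1 p.2) =
        ∑ q : Fin n × Bool, ∑ p : Fin n × Bool, (v p * w q) • (majorana n q.1 q.2 * majorana n p.1 p.2) := by
      rw [Finset.sum_mul]
      refine Finset.sum_congr rfl fun q _ => ?_
      rw [Finset.mul_sum]
      refine Finset.sum_congr rfl fun p _ => ?_
      rw [Matrix.smul_mul, Matrix.mul_smul, smul_smul, mul_comm (w q) (v p)]
    rw [h2', Finset.sum_comm]
  rw [h1, h2, ← Finset.sum_add_distrib]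
  simp_rw [← Finset.sum_add_distrib, ← smul_add, majorana_anticommutator]
  simp only [smul_ite, smul_zero, Finset.sum_ite_eq, Finset.mem_univ, if_true]
  rw [Finset.mul_sum, Finset.sum_smul]
  refine Finset.sum_congr rfl fun p _ => ?_
  rw [smul_smul, mul_comm]

/-- ISOTROPY OF ANNIHILATORS: if `c(v) ψ = 0` and `c(w) ψ = 0` for some `ψ ≠ 0` then `v · w = 0`
(apply the bilinear CAR to `ψ`).  In particular the `n` annihilators of an `IsGaussian` witness span a
TOTALLY ISOTROPIC subspace of `ℂ^{2n}` — automatically, with no orbit description of Gaussian states. [folklore] -/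
theorem annihilators_orthogonal {n : ℕ} {ψ : QReg n → ℂ} (hψ : ψ ≠ 0) {v w : Fin n × Bool → ℂ}
    (hv : (∑ p : Fin n × Bool, v p • majorana n p.1 p.2) *ᵥ ψ = 0)
    (hw : (∑ p : Fin n × Bool, w p • majorana n p.1 p.2) *ᵥ ψ = 0) :
    ∑ p : Fin n × Bool, v p * w p = 0 := by
  have key : ((∑ p : Fin n × Bool, v p • majorana n p.1 p.2) * (∑ q : Fin n × Bool, w q • majorana n q.1 q.2) +
      (∑ q : Fin n × Bool, w q • majorana n q.1 q.2) * (∑ p : Fin n × Bool, v p • majorana n p.1 p.2)) *ᵥ ψ =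
      (((2 : ℂ) * ∑ p : Fin n × Bool, v p * w p) • (1 : Matrix (QReg n) (QReg n) ℂ)) *ᵥ ψ := by
    rw [linComb_anticomm]
  rw [Matrix.add_mulVec, ← Matrix.mulVec_mulVec, ← Matrix.mulVec_mulVec, hw, hv, Matrix.mulVec_zero,
    Matrix.mulVec_zero, add_zero, Matrix.smul_mulVec, Matrix.one_mulVec] at key
  by_contra hne
  apply hψ
  have h2 : ((2 : ℂ) * ∑ p : Fin n × Bool, v p * w p) ≠ 0 := mul_ne_zero two_ne_zero hne
  have := congrArg (fun x => ((2 : ℂ) * ∑ p : Fin n × Bool, v p * w p)⁻¹ • x) key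
  simp only [smul_zero, smul_smul, inv_mul_cancel₀ h2, one_smul] at this
  exact this.symm

/-- Every vector of an annihilating family is isotropic and any two are orthogonal for the bilinear
form `v · w = Σ_p v_p w_p`: the Gram matrix of the family vanishes identically. [folklore] -/
theorem annihilatorFamily_isotropic {n m : ℕ} {ψ : QReg n → ℂ} (hψ : ψ ≠ 0)
    (A : Fin m → (Fin n × Bool → ℂ))
    (hann : ∀ k, (∑ p : Fin n × Bool, A k p • majorana n p.1 p.2) *ᵥ ψ = 0) (k l : Fin m) :
    ∑ p : Fin n × Bool, A k p * A l p = 0 :=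
  annihilators_orthogonal hψ (hann k) (hann l)

/-- MAXIMALITY: a nonzero vector on `n` qubits has at most `n` linearly independent annihilators among
the linear combinations of the `2n` Majoranas (an isotropic subspace of the non-degenerate symmetric
form `v · w` on `ℂ^{2n}` has dimension `≤ n`).  So the `IsGaussian` dictionary cannot be gamed from
above: its annihilator space is exactly Lagrangian. [folklore] -/
theorem card_annihilators_le {n m : ℕ} {ψ : QReg n → ℂ} (hψ : ψ ≠ 0)
    (A : Fin m → (Fin n × Bool → ℂ)) (hA : LinearIndependent ℂ A)
    (hann : ∀ k, (∑ p : Fin n × Bool, A k p • majorana n p.1 p.2) *ᵥ ψ = 0) : m ≤ n := by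
  classical
  let B : LinearMap.BilinForm ℂ (Fin n × Bool → ℂ) := Matrix.toBilin' 1
  have hB : ∀ v w : Fin n × Bool → ℂ, B v w = ∑ p, v p * w p := by
    intro v w
    show Matrix.toBilin' (1 : Matrix (Fin n × Bool) (Fin n × Bool) ℂ) v w = _
    rw [Matrix.toBilin'_apply', Matrix.one_mulVec]
    rfl
  have hrefl : B.IsRefl := by
    intro v w h
    rw [hB] at h ⊢
    rw [← h]
    exact Finset.sum_congr rfl fun p _ => mul_comm _ _
  have hker : LinearMap.ker B = ⊥ := by
    rw [Submodule.eq_bot_iff]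
    intro v hv
    funext p
    have h := LinearMap.congr_fun (LinearMap.mem_ker.1 hv) (Pi.single p 1)
    rw [hB, LinearMap.zero_apply] at h
    have : ∑ q : Fin n × Bool, v q * (Pi.single p (1 : ℂ) : Fin n × Bool → ℂ) q = v p := by
      rw [Finset.sum_eq_single p]
      · simp
      · intro q _ hq
        simp [hq]
      · simp
    rw [this] at h
    exact h
  let W : Submodule ℂ (Fin n × Bool → ℂ) := Submodule.span ℂ (Set.range A)
  have hW : Module.finrank ℂ W = m := by
    rw [finrank_span_eq_card hA, Fintype.card_fin]
  have hiso : W ≤ B.orthogonal W := by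
    rw [Submodule.span_le]
    rintro _ ⟨k, rfl⟩
    rw [SetLike.mem_coe, LinearMap.BilinForm.mem_orthogonal_iff]
    intro w hw
    show B w (A k) = 0
    have hle : W ≤ LinearMap.ker (B (A k)) := by
      rw [Submodule.span_le]
      rintro _ ⟨l, rfl⟩
      rw [SetLike.mem_coe, LinearMap.mem_ker, hB]
      exact annihilatorFamily_isotropic hψ A hann k l
    have h0 : B (A k) w = 0 := LinearMap.mem_ker.1 (hle hw)
    rw [hB] at h0 ⊢
    rw [← h0]
    exact Finset.sum_congr rfl fun p _ => mul_comm _ _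
  have hdim := LinearMap.BilinForm.finrank_add_finrank_orthogonal hrefl W
  rw [LinearMap.BilinForm.orthogonal_top_eq_ker hrefl, hker, inf_bot_eq, finrank_bot, add_zero,
    Module.finrank_fintype_fun_eq_card, Fintype.card_prod, Fintype.card_fin, Fintype.card_bool,
    hW] at hdim
  have hle : Module.finrank ℂ W ≤ Module.finrank ℂ (B.orthogonal W) := Submodule.finrank_mono hiso
  rw [hW] at hle
  omega

/-- Hence the dictionary with ONE MORE independent annihilator is EMPTY: no `ψ ≠ 0` on `n` qubits is
annihilated by `n + 1` linearly independent Majorana combinations.  (Had the crux been typed with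
`Fin (n+1)` — or `2n` — annihilators, it would be VACUOUSLY true; with `Fin n` it is the genuine
pure-spinor dictionary.) [folklore] -/
theorem no_overcomplete_annihilators (n : ℕ) :
    ¬ ∃ ψ : QReg n → ℂ, ψ ≠ 0 ∧ ∃ A : Fin (n + 1) → (Fin n × Bool → ℂ), LinearIndependent ℂ A ∧
      ∀ k, (∑ p : Fin n × Bool, A k p • majorana n p.1 p.2) *ᵥ ψ = 0 := by
  rintro ⟨ψ, hψ, A, hA, hann⟩
  have := card_annihilators_le hψ A hA hann
  omega

/-- For an `IsGaussian` state the annihilator family of any witness is isotropic (packaged form). [folklore] -/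
theorem IsGaussian.witness_isotropic {n : ℕ} {ψ : QReg n → ℂ} (hψ : ψ ≠ 0)
    {A : Fin n → (Fin n × Bool → ℂ)}
    (hann : ∀ k, (∑ p : Fin n × Bool, A k p • majorana n p.1 p.2) *ᵥ ψ = 0) :
    ∀ k l, ∑ p : Fin n × Bool, A k p * A l p = 0 :=
  fun k l => annihilatorFamily_isotropic hψ A hann k l


/-! ## §H Tightness of the constant `1` at EVERY `t` (generation 2) -/

/-- TIGHTNESS AT EVERY `t`: at `(t, K, r) = (t, 0, 0)` the count holds (`0 < 1`) and the conclusion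
of the crux holds with EQUALITY, `C(8t,0) · normSq (M^{⊗t} − 0) = 1` — the constant `1` on the left of
`1 ≤ C(8t,K) · normSq (…)` cannot be improved for any number of copies (generation 1 had `t = 1`). [folklore] -/
theorem flatteningBoundRobust_tight_K0 (t : ℕ) :
    0 * flatteningDeficiency 0 (t * 4) < t.choose 0 * 8 ^ 0 ∧
    ∀ (a : Fin 0 → ℂ) (g : Fin 0 → QReg (t * 4) → ℂ),
      ((t * 8).choose 0 : ℝ) * normSq (magicMPow t - ∑ i, a i • g i) = 1 := by
  refine ⟨by simp, fun a g => ?_⟩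
  rw [Finset.univ_eq_empty, Finset.sum_empty, sub_zero, normSq_magicMPow]
  simp

/-- … and for `K ≥ 1` (still `r = 0`, count `0 < C(t,K)·8^K` whenever `K ≤ t`) the conclusion holds
with room `C(8t,K) ≥ 8`: the `r = 0` slice of the crux is TRUE outright at every `t` (so a
counterexample needs `r ≥ 1`, where the count forces `K ≥ 1` and Gaussianity enters). [folklore] -/
theorem robust_slice_r0 (t K : ℕ) (a : Fin 0 → ℂ) (g : Fin 0 → QReg (t * 4) → ℂ)
    (hK : K ≤ t * 8) :
    (1 : ℝ) ≤ ((t * 8).choose K : ℝ) * normSq (magicMPow t - ∑ i, a i • g i) := by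
  rw [Finset.univ_eq_empty, Finset.sum_empty, sub_zero, normSq_magicMPow, mul_one]
  exact_mod_cast Nat.choose_pos hK

/-! ## §A5 The deficiency constant cannot be lowered by one -/

/-- THE DEFICIENCY COUNT `D_K(N)` IS SHARP AS A CONSTANT: the crux with `D_K(4t) − 1` in place of
`D_K(4t)` is false — it admits `(t,K,r) = (1,1,2)` (`2 · (4 − 1) = 6 < 8`), where the exact 2-term
block-string decomposition of `|M⟩` has residual `0`. [folklore] -/
theorem flatteningBoundRobust_false_with_deficiency_pred :
    ¬ ∀ t K r : ℕ, r * (flatteningDeficiency K (t * 4) - 1) < t.choose K * 8 ^ K →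
      ∀ (a : Fin r → ℂ) (g : Fin r → QReg (t * 4) → ℂ), (∀ i, IsGaussian (g i)) →
        (1 : ℝ) ≤ ((t * 8).choose K : ℝ) * normSq (magicMPow t - ∑ i, a i • g i) := by
  intro h
  have hcount : 2 * (flatteningDeficiency 1 (1 * 4) - 1) < Nat.choose 1 1 * 8 ^ 1 := by decide
  have hg : ∀ i : Fin 2, IsGaussian ((![basisState (fun _ => false), basisState (fun _ => true)] :
      Fin 2 → QReg (1 * 4) → ℂ) i) := by
    intro i
    fin_cases i
    · exact basisState_isGaussian _
    · exact basisState_isGaussian _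
  have key := h 1 1 2 hcount (fun _ : Fin 2 => ((Real.sqrt 2 : ℂ)⁻¹))
    (![basisState (fun _ => false), basisState (fun _ => true)] : Fin 2 → QReg (1 * 4) → ℂ) hg
  rw [← magicMPow_one_eq, sub_self] at key
  norm_num [normSq] at key

end Summit.QuantumAdvantage.QuantumAdvantage.Theorems.FlatteningBoundRobust.Negative
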